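/-
Copyright: the b2b-balaban T⁴-continuum CRUX team, row NE7b leaf lineage `t4-ne7b-formalise-leaf-03` (gen 150). Project licence.
-/
import Summits.QuantumFields.BalabanUV.T4Continuum.Spine.NE7b.HardStepTransportedLetters
import Mathlib.Analysis.Normed.Operator.Bilinear
import Mathlib.Analysis.Calculus.FDeriv.Basic

/-!
# THE PROPAGATOR MOVES LITTLE WHEN THE FORM MOVES LITTLE: the critical sections `T`, `T′` of ONE blocking `D` for two forms `Q`, `Q′`
# differ by `‖T′h − Th‖ ≤ (‖Q′ − Q‖∕m)·‖T′h‖` (`m` = kernel coercivity of `Q`; no equivalence constant `N`, no `‖Q‖∕m`); hence along a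
# hard-step chart with the modulus letter `‖V″(σw) − V″(δ₀)‖ ≤ c < m` the branch derivative stays within relative distance `c∕(m − c)`
# of the LINEAR propagator `T₀` and **`‖σ′(w)‖ ≤ (m∕(m − c))·‖T₀‖`** — a chart constant from variational letters, DECOUPLED FROM `N`
# (the pricing desk's located debt (α), F686); and the step's next Hessian differs from the Gaussian skeleton's `Q₀[T₀·, T₀·]` by
# `O(c)` — the perturbative wrapper around the closed form (row NE7b, node U5c; [folklore] linear algebra)

Cell `pub-balaban`, sub-cell `t4`, spine estimate NE7b (`T4WeightBudget.RelWeightBound`; the cell's OWN estimate — NOT PRINTED in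
[Bałaban 1983–89], NOT PROVED).  Crux-route work under `Spine/NE7b/` by leaf-03 (CRUX team (2), FREEZE (0) crux-prover clause) in the
hard-step cell.  NOTHING of Bałaban's is named, asserted, valued or discharged; no `T4Continuum/Support` leaf typed; no `def`; zero
`sorry`.  Imports: leaf-06's BUILT `…HardStepTransportedLetters` (HSTL: the three-term bound `norm_bilinearComp_sub_le` BY NAME) +
Mathlib.  Met BY SHAPE (not imported, nothing restated): this lineage's QFM (the propagator `T₀` of `Q₀ = V″(δ₀)`: `D ∘ T₀ = 1`,
`Q₀ (T₀ h)|_{ker D} = 0`), leaf-04's HSBD ∕ leaf-06's HSIS ∕ HSIC + THEC `orthogonal_of_criticalBranch` (the branch derivative `σ′(w)` is a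
section of `D` with `V″(σw)(σ′(w) h)|_{ker D} = 0`), HSIS's modulus letter `hVc : ‖V″ x − V″ δ₀‖ ≤ c` on the fibre ball, THEC §1c
(`‖T₀‖ ≤ ‖S‖ + √(C∕m)` through a test section), this lineage's HSSG ∕ HSGT (the skeleton `Q₀[T₀·,T₀·]` along the tower).

WHY.  The unit box's chart letter is `K₁ = (N⁻¹ − c)⁻¹` (HSCR ∕ HSBD: the Neumann series on the augmented equivalence `A`, `‖A⁻¹‖ ≤ N`
from AHE's `N = (1 + ‖Q₀‖∕m)‖M‖ + m⁻¹`).  The pricing desk located (F686, F689 (4)) that THIS letter alone empties the box on every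
non-trivial blocking (`K₁ d ≥ 1 + x_B`, `Θ ≥ 4`), while the true branch derivative of the free field has `‖σ′‖·‖D‖ = 1.09 ∕ 1.12`, and
asked for «the chart constant from the actual inverse letters, `K₁` decoupled from `N`» (α).  The variational mechanism is one line:
`σ′(w)h` and `T₀ h` lie in ONE `D`-fibre, `σ′(w) h` is `V″(σw)`-orthogonal and `T₀ h` is `Q₀`-orthogonal to `ker D`, so for
`η = σ′(w)h − T₀h ∈ ker D`: `m‖η‖² ≤ Q₀ η η = Q₀(σ′h) η = (Q₀ − V″(σw))(σ′h) η ≤ c‖σ′h‖‖η‖` — the propagator's first-order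
perturbation WITHOUT a resolvent: `‖η‖ ≤ (c∕m)‖σ′(w)h‖`, whence `‖σ′(w)‖ ≤ (m∕(m − c))‖T₀‖` for `c < m`.  With THEC §1c's `‖T₀‖ ≤
‖S‖ + √(C∕m)` every factor is variational; for the free field (`c = 0`) the letter is EXACT (`σ′ = T₀`).  The same `η`-bound makes the
NONLINEAR step a perturbation of the Gaussian skeleton: `‖V″(σw)[σ′·,σ′·] − Q₀[T₀·,T₀·]‖ = O(c)` (§3, HSTL's three-term bound), which is
the shape F689 (5) names («the letter box survives only as the perturbative wrapper around the closed form»).  NOT a new radius: the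
chart's EXISTENCE radius is still HSCR's (its Neumann condition `c < N⁻¹` is where `N` remains) — said under NOT HERE.

WHAT IS PROVED ([folklore]; `E`, `F` real normed spaces, `Q`, `Q′ : E →L E →L ℝ` (no symmetry), `D : E →L F`, sections `T`, `T′ : F →L E`;
the CRITICALITY letters `Q (T h)|_{ker D} = 0`, `Q′ (T′ h)|_{ker D} = 0`; kernel coercivity `m‖κ‖² ≤ Q κ κ` on `ker D`, `0 < m`):
* §1 THE PROPAGATOR's FIRST-ORDER PERTURBATION: `le_div_of_mul_sq_le` (bookkeeping: `m x² ≤ a x`, `0 ≤ x` ⟹ `x ≤ a∕m`),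
  **`norm_sub_apply_le_of_critical`** (`‖T′ h − T h‖ ≤ (‖Q − Q′‖∕m)·‖T′ h‖`), `norm_sub_apply_le_of_modulus` (`‖Q − Q′‖ ≤ c` ⟹
  `≤ (c∕m)‖T′ h‖`), `opNorm_sub_le_of_modulus` (`‖T′ − T‖ ≤ (c∕m)‖T′‖`).
* §2 THE CHART CONSTANT DECOUPLED FROM `N`: **`norm_apply_le_of_modulus`** (`c < m` ⟹ `‖T′ h‖ ≤ (m∕(m − c))·‖T h‖`),
  **`opNorm_le_of_modulus`** (`‖T′‖ ≤ (m∕(m − c))·‖T‖`), `opNorm_sub_le_of_modulus'` (`‖T′ − T‖ ≤ (c∕(m − c))·‖T‖` — both sides in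
  the UNPERTURBED propagator), `norm_apply_ge_of_modulus` (`‖T h‖ ≤ (1 + c∕m)‖T′ h‖`, the reverse comparison).
* §3 THE PERTURBATIVE WRAPPER: **`norm_transported_sub_skeleton_le`** (`‖Q′[T′·,T′·] − Q[T·,T·]‖ ≤ c‖T′‖² + ‖Q‖(‖T′‖ + ‖T‖)·(c∕m)‖T′‖`
  — HSTL `norm_bilinearComp_sub_le` BY NAME + §1), `norm_transported_sub_skeleton_le'` (the same in the unperturbed letters only:
  `≤ (c·K² + ‖Q‖·(K + ‖T‖)·(c∕m)·K)` with `K := (m∕(m − c))‖T‖`).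
* §4 ON THE CHART (HSIS ∕ HSIC shapes, at a point `w`): **`opNorm_fderiv_branch_le`** — `σ` differentiable at `w` with `D (σ′(w) k) = k`,
  the orthogonality letter `V″(σ w)(σ′(w) h)|_{ker D} = 0` (THEC `orthogonal_of_criticalBranch` from HSIC (o)), a `Q₀`-critical section
  `T₀` (QFM's propagator of `Q₀ = V″(δ₀)`), `Q₀` `m`-coercive on `ker D`, the modulus letter `‖V″(σ w) − Q₀‖ ≤ c` (HSIS `hVc` at
  `x = σ w`), `c < m` ⟹ **`‖fderiv σ w‖ ≤ (m∕(m − c))·‖T₀‖`** and `‖fderiv σ w − T₀‖ ≤ (c∕(m − c))·‖T₀‖`; `opNorm_fderiv_branch_le_on`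
  (the same at every point of a chart set).  ALONG THE TOWER (this lineage's HSGT `tower_branch_letters` + THEC
  `orthogonal_of_criticalBranch` at level `k`): §4 applies VERBATIM with `(D, σ, T₀, m) := (Dc k, σc k, Tc k, m_k)` — the composite
  branch's derivative is the `V″(σc k g)`-critical section of the COMPOSITE blocking and `Tc k` the `Q₀`-critical one, so
  `‖(σc k)′(g)‖ ≤ (m_k∕(m_k − c))·‖Tc k‖` with the SAME fine-level modulus `c = ‖V″(σc k g) − Q₀‖` and the `k`-scale coercivity `m_k`
  of `Q₀` on `ker (Dc k)`: ONE factor per level, read at the composite — never a product `Π_j (1 − c_j∕m_j)⁻¹` of per-step factors.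
* §5 toy (`ℝ`, `Q = Q′ = mul`, `D = T = T′ = 1`, `m = 1`: `‖T′ h − T h‖ ≤ ‖mul − mul‖∕1·‖T′h‖`).

NOT HERE (honest): the chart's existence RADIUS (HSCR's inverse-function construction keeps its Neumann condition `c < N⁻¹`; a
continuation argument on the region `c < m` is analysis not done here); symmetric-`Q` packaging; the letters BY VALUE for Bałaban's
actions ((A3) ∕ (A1c), NC-NE7b-α UNRULED); anything of Bałaban's.  BY-NAME EFFECT ON THE WALL: NONE.  NE7b NOT PRINTED ∕ NOT PROVED;
spine PROVED 0∕9; rung (B)+1 on a FINITE torus — NOT infinite volume, NOT the mass gap, NOT Clay.  HONEST DEPENDENCY: continuum YM on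
T⁴ ⇐ BetaPertH ∧ nine spine estimates (0∕9 proved); BetaPertH ⇐ (D1) ∧ (D4) ∧ CAP+tail; G-an2-4 gates asym, D1 and NE2∕3∕4.
-/

set_option autoImplicit false

namespace Summit.QuantumFields.BalabanUV.T4Continuum.NE7b.PropagatorPerturbation

open Summit.QuantumFields.BalabanUV.T4Continuum.NE7b

variable {E F : Type*} [NormedAddCommGroup E] [NormedSpace ℝ E] [NormedAddCommGroup F] [NormedSpace ℝ F]

/-! ## §1. The propagator's first-order perturbation (no resolvent, no equivalence constant) -/

omit [NormedSpace ℝ E] [NormedAddCommGroup F] [NormedSpace ℝ F] in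
/-- Bookkeeping: `m·x² ≤ a·x` with `0 < m`, `0 ≤ x`, `0 ≤ a` ⟹ `x ≤ a∕m`. [folklore] -/
theorem le_div_of_mul_sq_le {m a x : ℝ} (hm : 0 < m) (hx : 0 ≤ x) (ha : 0 ≤ a) (h : m * x ^ 2 ≤ a * x) : x ≤ a / m := by
  rcases hx.eq_or_lt with hx0 | hxpos
  · rw [← hx0]; positivity
  · rw [le_div_iff₀ hm]
    have : m * x * x ≤ a * x := by nlinarith
    have := le_of_mul_le_mul_right this hxpos
    linarith

/-- **THE PROPAGATOR's FIRST-ORDER PERTURBATION.**  `T`, `T′` sections of `D`; `T` is `Q`-critical (`Q (T h) κ = 0` on `ker D`), `T′`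
is `Q′`-critical; `Q` is `m`-coercive on `ker D` ⟹ `‖T′ h − T h‖ ≤ (‖Q − Q′‖∕m)·‖T′ h‖`: with `η = T′h − Th ∈ ker D`,
`m‖η‖² ≤ Q η η = Q (T′h) η = (Q − Q′)(T′h) η ≤ ‖Q − Q′‖‖T′h‖‖η‖`. [folklore] -/
theorem norm_sub_apply_le_of_critical (Q Q' : E →L[ℝ] E →L[ℝ] ℝ) {D : E →L[ℝ] F} {T T' : F →L[ℝ] E}
    (hT : ∀ k, D (T k) = k) (hT' : ∀ k, D (T' k) = k) (hTo : ∀ h κ, D κ = 0 → Q (T h) κ = 0)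
    (hT'o : ∀ h κ, D κ = 0 → Q' (T' h) κ = 0) {m : ℝ} (hm : 0 < m) (hco : ∀ κ, D κ = 0 → m * ‖κ‖ ^ 2 ≤ Q κ κ) (h : F) :
    ‖T' h - T h‖ ≤ ‖Q - Q'‖ / m * ‖T' h‖ := by
  have hκ : D (T' h - T h) = 0 := by rw [map_sub, hT', hT, sub_self]
  have h1 := hco _ hκ
  have e : Q (T' h - T h) (T' h - T h) = (Q - Q') (T' h) (T' h - T h) := by
    rw [map_sub Q (T' h) (T h), sub_apply, hTo h _ hκ, sub_zero, sub_apply Q Q' (T' h), sub_apply, hT'o h _ hκ, sub_zero]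
  rw [e] at h1
  have h2 : (Q - Q') (T' h) (T' h - T h) ≤ ‖Q - Q'‖ * ‖T' h‖ * ‖T' h - T h‖ :=
    (le_abs_self _).trans (by simpa only [Real.norm_eq_abs] using (Q - Q').le_opNorm₂ (T' h) (T' h - T h))
  have h3 := le_div_of_mul_sq_le hm (norm_nonneg _) (by positivity) (h1.trans h2)
  calc ‖T' h - T h‖ ≤ ‖Q - Q'‖ * ‖T' h‖ / m := h3
    _ = ‖Q - Q'‖ / m * ‖T' h‖ := by ring

/-- The same with a MODULUS letter `‖Q − Q′‖ ≤ c`: `‖T′ h − T h‖ ≤ (c∕m)·‖T′ h‖`. [folklore] -/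
theorem norm_sub_apply_le_of_modulus (Q Q' : E →L[ℝ] E →L[ℝ] ℝ) {D : E →L[ℝ] F} {T T' : F →L[ℝ] E}
    (hT : ∀ k, D (T k) = k) (hT' : ∀ k, D (T' k) = k) (hTo : ∀ h κ, D κ = 0 → Q (T h) κ = 0)
    (hT'o : ∀ h κ, D κ = 0 → Q' (T' h) κ = 0) {m : ℝ} (hm : 0 < m) (hco : ∀ κ, D κ = 0 → m * ‖κ‖ ^ 2 ≤ Q κ κ)
    {c : ℝ} (hc : ‖Q - Q'‖ ≤ c) (h : F) : ‖T' h - T h‖ ≤ c / m * ‖T' h‖ :=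
  (norm_sub_apply_le_of_critical Q Q' hT hT' hTo hT'o hm hco h).trans
    (mul_le_mul_of_nonneg_right (div_le_div_of_nonneg_right hc hm.le) (norm_nonneg _))

/-- Operator-norm form: `‖T′ − T‖ ≤ (c∕m)·‖T′‖`. [folklore] -/
theorem opNorm_sub_le_of_modulus (Q Q' : E →L[ℝ] E →L[ℝ] ℝ) {D : E →L[ℝ] F} {T T' : F →L[ℝ] E}
    (hT : ∀ k, D (T k) = k) (hT' : ∀ k, D (T' k) = k) (hTo : ∀ h κ, D κ = 0 → Q (T h) κ = 0)
    (hT'o : ∀ h κ, D κ = 0 → Q' (T' h) κ = 0) {m : ℝ} (hm : 0 < m) (hco : ∀ κ, D κ = 0 → m * ‖κ‖ ^ 2 ≤ Q κ κ)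
    {c : ℝ} (hc0 : 0 ≤ c) (hc : ‖Q - Q'‖ ≤ c) : ‖T' - T‖ ≤ c / m * ‖T'‖ := by
  refine ContinuousLinearMap.opNorm_le_bound _ (by positivity) fun h => ?_
  rw [sub_apply]
  calc ‖T' h - T h‖ ≤ c / m * ‖T' h‖ := norm_sub_apply_le_of_modulus Q Q' hT hT' hTo hT'o hm hco hc h
    _ ≤ c / m * (‖T'‖ * ‖h‖) := mul_le_mul_of_nonneg_left (T'.le_opNorm h) (by positivity)
    _ = c / m * ‖T'‖ * ‖h‖ := by ring

/-! ## §2. The chart constant decoupled from `N`: `‖T′‖ ≤ (m∕(m − c))‖T‖` -/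

/-- **`‖T′ h‖ ≤ (m∕(m − c))·‖T h‖` for `c < m`**: from `‖T′h‖ ≤ ‖Th‖ + (c∕m)‖T′h‖`. [folklore] -/
theorem norm_apply_le_of_modulus (Q Q' : E →L[ℝ] E →L[ℝ] ℝ) {D : E →L[ℝ] F} {T T' : F →L[ℝ] E}
    (hT : ∀ k, D (T k) = k) (hT' : ∀ k, D (T' k) = k) (hTo : ∀ h κ, D κ = 0 → Q (T h) κ = 0)
    (hT'o : ∀ h κ, D κ = 0 → Q' (T' h) κ = 0) {m : ℝ} (hm : 0 < m) (hco : ∀ κ, D κ = 0 → m * ‖κ‖ ^ 2 ≤ Q κ κ)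
    {c : ℝ} (hc : ‖Q - Q'‖ ≤ c) (hcm : c < m) (h : F) : ‖T' h‖ ≤ m / (m - c) * ‖T h‖ := by
  have h1 := norm_sub_apply_le_of_modulus Q Q' hT hT' hTo hT'o hm hco hc h
  have h2 : ‖T' h‖ ≤ ‖T h‖ + c / m * ‖T' h‖ := by
    calc ‖T' h‖ = ‖T h + (T' h - T h)‖ := by rw [add_sub_cancel]
      _ ≤ ‖T h‖ + ‖T' h - T h‖ := norm_add_le _ _
      _ ≤ ‖T h‖ + c / m * ‖T' h‖ := by linarith
  have hmc : 0 < m - c := sub_pos.2 hcm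
  rw [div_mul_eq_mul_div, le_div_iff₀ hmc]
  have h4 : m * (c / m * ‖T' h‖) = c * ‖T' h‖ := by field_simp
  have h5 : m * ‖T' h‖ ≤ m * (‖T h‖ + c / m * ‖T' h‖) := mul_le_mul_of_nonneg_left h2 hm.le
  rw [mul_add, h4] at h5
  linarith

/-- **THE CHART CONSTANT FROM VARIATIONAL LETTERS**: `‖T′‖ ≤ (m∕(m − c))·‖T‖` (`c < m`) — no equivalence constant `N`, no
`‖Q‖∕m`. [folklore] -/
theorem opNorm_le_of_modulus (Q Q' : E →L[ℝ] E →L[ℝ] ℝ) {D : E →L[ℝ] F} {T T' : F →L[ℝ] E}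
    (hT : ∀ k, D (T k) = k) (hT' : ∀ k, D (T' k) = k) (hTo : ∀ h κ, D κ = 0 → Q (T h) κ = 0)
    (hT'o : ∀ h κ, D κ = 0 → Q' (T' h) κ = 0) {m : ℝ} (hm : 0 < m) (hco : ∀ κ, D κ = 0 → m * ‖κ‖ ^ 2 ≤ Q κ κ)
    {c : ℝ} (hc : ‖Q - Q'‖ ≤ c) (hcm : c < m) : ‖T'‖ ≤ m / (m - c) * ‖T‖ := by
  have hmc : 0 < m - c := sub_pos.2 hcm
  refine ContinuousLinearMap.opNorm_le_bound _ (by positivity) fun h => ?_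
  calc ‖T' h‖ ≤ m / (m - c) * ‖T h‖ := norm_apply_le_of_modulus Q Q' hT hT' hTo hT'o hm hco hc hcm h
    _ ≤ m / (m - c) * (‖T‖ * ‖h‖) := mul_le_mul_of_nonneg_left (T.le_opNorm h) (by positivity)
    _ = m / (m - c) * ‖T‖ * ‖h‖ := by ring

/-- The perturbation in the UNPERTURBED letters: `‖T′ − T‖ ≤ (c∕(m − c))·‖T‖` (`0 ≤ c < m`). [folklore] -/
theorem opNorm_sub_le_of_modulus' (Q Q' : E →L[ℝ] E →L[ℝ] ℝ) {D : E →L[ℝ] F} {T T' : F →L[ℝ] E}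
    (hT : ∀ k, D (T k) = k) (hT' : ∀ k, D (T' k) = k) (hTo : ∀ h κ, D κ = 0 → Q (T h) κ = 0)
    (hT'o : ∀ h κ, D κ = 0 → Q' (T' h) κ = 0) {m : ℝ} (hm : 0 < m) (hco : ∀ κ, D κ = 0 → m * ‖κ‖ ^ 2 ≤ Q κ κ)
    {c : ℝ} (hc0 : 0 ≤ c) (hc : ‖Q - Q'‖ ≤ c) (hcm : c < m) : ‖T' - T‖ ≤ c / (m - c) * ‖T‖ := by
  have hmc : 0 < m - c := sub_pos.2 hcm
  have h1 := opNorm_sub_le_of_modulus Q Q' hT hT' hTo hT'o hm hco hc0 hc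
  have h2 := opNorm_le_of_modulus Q Q' hT hT' hTo hT'o hm hco hc hcm
  calc ‖T' - T‖ ≤ c / m * ‖T'‖ := h1
    _ ≤ c / m * (m / (m - c) * ‖T‖) := mul_le_mul_of_nonneg_left h2 (by positivity)
    _ = c / (m - c) * ‖T‖ := by field_simp

/-- The reverse comparison: `‖T h‖ ≤ (1 + c∕m)·‖T′ h‖`. [folklore] -/
theorem norm_apply_ge_of_modulus (Q Q' : E →L[ℝ] E →L[ℝ] ℝ) {D : E →L[ℝ] F} {T T' : F →L[ℝ] E}
    (hT : ∀ k, D (T k) = k) (hT' : ∀ k, D (T' k) = k) (hTo : ∀ h κ, D κ = 0 → Q (T h) κ = 0)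
    (hT'o : ∀ h κ, D κ = 0 → Q' (T' h) κ = 0) {m : ℝ} (hm : 0 < m) (hco : ∀ κ, D κ = 0 → m * ‖κ‖ ^ 2 ≤ Q κ κ)
    {c : ℝ} (hc : ‖Q - Q'‖ ≤ c) (h : F) : ‖T h‖ ≤ (1 + c / m) * ‖T' h‖ := by
  have h1 := norm_sub_apply_le_of_modulus Q Q' hT hT' hTo hT'o hm hco hc h
  calc ‖T h‖ = ‖T' h - (T' h - T h)‖ := by rw [sub_sub_cancel]
    _ ≤ ‖T' h‖ + ‖T' h - T h‖ := norm_sub_le _ _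
    _ ≤ ‖T' h‖ + c / m * ‖T' h‖ := by linarith
    _ = (1 + c / m) * ‖T' h‖ := by ring

/-! ## §3. The perturbative wrapper: the transported form minus the skeleton's is `O(c)` -/

/-- **THE NEXT HESSIAN MINUS THE GAUSSIAN SKELETON's**: `‖Q′[T′·,T′·] − Q[T·,T·]‖ ≤ c‖T′‖² + ‖Q‖·‖T′ − T‖·‖T′‖ + ‖Q‖·‖T‖·‖T′ − T‖`
with `‖T′ − T‖ ≤ (c∕m)‖T′‖` — HSTL `norm_bilinearComp_sub_le` BY NAME + §1: every term carries a factor `c`. [folklore] -/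
theorem norm_transported_sub_skeleton_le (Q Q' : E →L[ℝ] E →L[ℝ] ℝ) {D : E →L[ℝ] F} {T T' : F →L[ℝ] E}
    (hT : ∀ k, D (T k) = k) (hT' : ∀ k, D (T' k) = k) (hTo : ∀ h κ, D κ = 0 → Q (T h) κ = 0)
    (hT'o : ∀ h κ, D κ = 0 → Q' (T' h) κ = 0) {m : ℝ} (hm : 0 < m) (hco : ∀ κ, D κ = 0 → m * ‖κ‖ ^ 2 ≤ Q κ κ)
    {c : ℝ} (hc0 : 0 ≤ c) (hc : ‖Q' - Q‖ ≤ c) :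
    ‖Q'.bilinearComp T' T' - Q.bilinearComp T T‖ ≤
      c * ‖T'‖ * ‖T'‖ + ‖Q‖ * (c / m * ‖T'‖) * ‖T'‖ + ‖Q‖ * ‖T‖ * (c / m * ‖T'‖) := by
  have hc' : ‖Q - Q'‖ ≤ c := (norm_sub_rev Q Q').trans_le hc
  have hd := opNorm_sub_le_of_modulus Q Q' hT hT' hTo hT'o hm hco hc0 hc'
  have h3 := HardStepTransportedLetters.norm_bilinearComp_sub_le Q' Q T' T
  calc ‖Q'.bilinearComp T' T' - Q.bilinearComp T T‖
      ≤ ‖Q' - Q‖ * ‖T'‖ * ‖T'‖ + ‖Q‖ * ‖T' - T‖ * ‖T'‖ + ‖Q‖ * ‖T‖ * ‖T' - T‖ := h3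
    _ ≤ c * ‖T'‖ * ‖T'‖ + ‖Q‖ * (c / m * ‖T'‖) * ‖T'‖ + ‖Q‖ * ‖T‖ * (c / m * ‖T'‖) := by
        gcongr

/-- The same in the UNPERTURBED letters only: with `K := (m∕(m − c))·‖T‖` (§2), `‖Q′[T′·,T′·] − Q[T·,T·]‖ ≤ c·K² + ‖Q‖·(c∕m)·K·K +
‖Q‖·‖T‖·(c∕m)·K` (`0 ≤ c < m`). [folklore] -/
theorem norm_transported_sub_skeleton_le' (Q Q' : E →L[ℝ] E →L[ℝ] ℝ) {D : E →L[ℝ] F} {T T' : F →L[ℝ] E}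
    (hT : ∀ k, D (T k) = k) (hT' : ∀ k, D (T' k) = k) (hTo : ∀ h κ, D κ = 0 → Q (T h) κ = 0)
    (hT'o : ∀ h κ, D κ = 0 → Q' (T' h) κ = 0) {m : ℝ} (hm : 0 < m) (hco : ∀ κ, D κ = 0 → m * ‖κ‖ ^ 2 ≤ Q κ κ)
    {c : ℝ} (hc0 : 0 ≤ c) (hc : ‖Q' - Q‖ ≤ c) (hcm : c < m) :
    ‖Q'.bilinearComp T' T' - Q.bilinearComp T T‖ ≤
      c * (m / (m - c) * ‖T‖) * (m / (m - c) * ‖T‖) + ‖Q‖ * (c / m * (m / (m - c) * ‖T‖)) * (m / (m - c) * ‖T‖) +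
        ‖Q‖ * ‖T‖ * (c / m * (m / (m - c) * ‖T‖)) := by
  have hc' : ‖Q - Q'‖ ≤ c := (norm_sub_rev Q Q').trans_le hc
  have hK := opNorm_le_of_modulus Q Q' hT hT' hTo hT'o hm hco hc' hcm
  have hmc : 0 < m - c := sub_pos.2 hcm
  have h0 : 0 ≤ m / (m - c) * ‖T‖ := by positivity
  calc ‖Q'.bilinearComp T' T' - Q.bilinearComp T T‖
      ≤ c * ‖T'‖ * ‖T'‖ + ‖Q‖ * (c / m * ‖T'‖) * ‖T'‖ + ‖Q‖ * ‖T‖ * (c / m * ‖T'‖) :=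
        norm_transported_sub_skeleton_le Q Q' hT hT' hTo hT'o hm hco hc0 hc
    _ ≤ c * (m / (m - c) * ‖T‖) * (m / (m - c) * ‖T‖) + ‖Q‖ * (c / m * (m / (m - c) * ‖T‖)) * (m / (m - c) * ‖T‖) +
        ‖Q‖ * ‖T‖ * (c / m * (m / (m - c) * ‖T‖)) := by
        gcongr

/-! ## §4. On the chart: `‖σ′(w)‖ ≤ (m∕(m − c))‖T₀‖` — the chart letter from variational letters -/

/-- **THE BRANCH DERIVATIVE AGAINST THE LINEAR PROPAGATOR, AT A CHART POINT.**  `σ` differentiable at `w` with the section letter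
`D (σ′(w) k) = k` (HSBD ∕ HSIS (a)), the orthogonality letter `V″(σ w)(σ′(w) h) κ = 0` on `ker D` (THEC `orthogonal_of_criticalBranch` from
HSIC (o)), `T₀` a `Q₀`-critical section (QFM's propagator of `Q₀ = V″(δ₀)`), `Q₀` `m`-coercive on `ker D`, and the modulus letter
`‖V″(σ w) − Q₀‖ ≤ c` (HSIS `hVc` at `x = σ w`) with `c < m` ⟹ `‖fderiv σ w‖ ≤ (m∕(m − c))·‖T₀‖` and `‖fderiv σ w − T₀‖ ≤ (c∕(m − c))·‖T₀‖`
— the chart constant `K₁ := (m∕(m − c))‖T₀‖`, decoupled from AHE's `N`. [folklore] -/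
theorem opNorm_fderiv_branch_le {V'' : E → E →L[ℝ] E →L[ℝ] ℝ} {σ : F → E} (D : E →L[ℝ] F) {w : F}
    (hsec : ∀ k, D (fderiv ℝ σ w k) = k) (horth : ∀ h κ, D κ = 0 → V'' (σ w) (fderiv ℝ σ w h) κ = 0)
    (Q₀ : E →L[ℝ] E →L[ℝ] ℝ) {T₀ : F →L[ℝ] E} (hT₀ : ∀ k, D (T₀ k) = k) (hT₀o : ∀ h κ, D κ = 0 → Q₀ (T₀ h) κ = 0)
    {m : ℝ} (hm : 0 < m) (hco : ∀ κ, D κ = 0 → m * ‖κ‖ ^ 2 ≤ Q₀ κ κ) {c : ℝ} (hc0 : 0 ≤ c) (hc : ‖V'' (σ w) - Q₀‖ ≤ c)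
    (hcm : c < m) :
    ‖fderiv ℝ σ w‖ ≤ m / (m - c) * ‖T₀‖ ∧ ‖fderiv ℝ σ w - T₀‖ ≤ c / (m - c) * ‖T₀‖ := by
  have hc' : ‖Q₀ - V'' (σ w)‖ ≤ c := (norm_sub_rev Q₀ (V'' (σ w))).trans_le hc
  exact ⟨opNorm_le_of_modulus Q₀ (V'' (σ w)) hT₀ hsec hT₀o horth hm hco hc' hcm,
    opNorm_sub_le_of_modulus' Q₀ (V'' (σ w)) hT₀ hsec hT₀o horth hm hco hc0 hc' hcm⟩

/-- The same at every point of a chart set `U` (HSIC's conclusion shapes quantified over `w ∈ U`). [folklore] -/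
theorem opNorm_fderiv_branch_le_on {V'' : E → E →L[ℝ] E →L[ℝ] ℝ} {σ : F → E} (D : E →L[ℝ] F) {U : Set F}
    (hsec : ∀ w ∈ U, ∀ k, D (fderiv ℝ σ w k) = k) (horth : ∀ w ∈ U, ∀ h κ, D κ = 0 → V'' (σ w) (fderiv ℝ σ w h) κ = 0)
    (Q₀ : E →L[ℝ] E →L[ℝ] ℝ) {T₀ : F →L[ℝ] E} (hT₀ : ∀ k, D (T₀ k) = k) (hT₀o : ∀ h κ, D κ = 0 → Q₀ (T₀ h) κ = 0)
    {m : ℝ} (hm : 0 < m) (hco : ∀ κ, D κ = 0 → m * ‖κ‖ ^ 2 ≤ Q₀ κ κ) {c : ℝ} (hc0 : 0 ≤ c)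
    (hc : ∀ w ∈ U, ‖V'' (σ w) - Q₀‖ ≤ c) (hcm : c < m) :
    ∀ w ∈ U, ‖fderiv ℝ σ w‖ ≤ m / (m - c) * ‖T₀‖ ∧ ‖fderiv ℝ σ w - T₀‖ ≤ c / (m - c) * ‖T₀‖ :=
  fun w hw => opNorm_fderiv_branch_le D (hsec w hw) (horth w hw) Q₀ hT₀ hT₀o hm hco hc0 (hc w hw) hcm

/-! ## §5. Toy -/

/-- Toy (`E = F = ℝ`, `Q = Q′ = mul`, `D = T = T′ = 1`, `m = 1`): §1 reads `‖T′h − Th‖ ≤ ‖mul − mul‖∕1·‖T′h‖` (both sides `0`). -/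
example (h : ℝ) : ‖ContinuousLinearMap.id ℝ ℝ h - ContinuousLinearMap.id ℝ ℝ h‖ ≤
    ‖ContinuousLinearMap.mul ℝ ℝ - ContinuousLinearMap.mul ℝ ℝ‖ / 1 * ‖ContinuousLinearMap.id ℝ ℝ h‖ :=
  norm_sub_apply_le_of_critical (ContinuousLinearMap.mul ℝ ℝ) (ContinuousLinearMap.mul ℝ ℝ) (D := ContinuousLinearMap.id ℝ ℝ)
    (fun _ => rfl) (fun _ => rfl) (fun h κ hκ => by simp only [ContinuousLinearMap.coe_id', id_eq] at hκ; subst hκ; simp)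
    (fun h κ hκ => by simp only [ContinuousLinearMap.coe_id', id_eq] at hκ; subst hκ; simp) one_pos
    (fun κ _ => by rw [ContinuousLinearMap.mul_apply', one_mul, Real.norm_eq_abs, sq_abs, sq]) h

end Summit.QuantumFields.BalabanUV.T4Continuum.NE7b.PropagatorPerturbation
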